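import Summits.BirchSwinnertonDyer.BirchSwinnertonDyer.Theses.ShaPrimaryTransfer
import Literature.NumberTheory.EllipticCurves.ShaRestriction
import Literature.NumberTheory.EllipticCurves.BSDSelmerParityDokchitserBaseChangeProofs
import Literature.NumberTheory.EllipticCurves.LeadingTermProofs
import Literature.NumberTheory.EllipticCurves.SelmerCorankHolds
import Literature.NumberTheory.EllipticCurves.IwasawaLeadingTermProofs
import Literature.NumberTheory.EllipticCurves.ZpCorankQuasiIso
import Literature.NumberTheory.EllipticCurves.ShaFiniteProofs
import Literature.NumberTheory.EllipticCurves.QuadraticTwist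
import Literature.Algebra.Module.AlternatingPairingParity
import HarnessLib

/-!
# BirchSwinnertonDyer / ShaPrimaryTransfer — crux `FiniteShaComponentTransfer` (stmt-BirchSwinnertonDyer-22356):
# BASE CHANGE AND THE TRANSFER — `t_p(E/K) ≤ t_p(E_L/L)` along every finite extension, and
# `t_p(E_K) = t_p(E) + t_p(E^{(d_K)})` over a quadratic field, for EVERY prime `p`

Helper file of prover seat `bsd-line-spt-p1` g14 (`--supports stmt-22356 --as helper`). THEOREMS ONLY (no definition,
no named fact, no `sorry`, no instance). The route's crux T = `FiniteShaComponentTransfer` («`t_p(E) = 0 → t_q(E) = 0`» for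
every elliptic `E/ℚ`, `t_p(E) := W.shaCorank p = corank_{ℤ_p} Ш(E/ℚ)[p^∞]`) and its door O = `OneFiniteShaComponent` are
statements over `ℚ`; the route's instruments (descents, Kolyvagin over a Heegner field, the odd door) often run over a
number field. This file fixes, unconditionally and class-wide, how the corank `t_p` moves under base change, so that a
door certified UPSTAIRS counts downstairs and a quadratic base change splits into the curve and its twist:

* §1 (any finite extension `L/K` of number fields, any elliptic `E/K`, any prime `p`):
  `t_p(E/K) ≤ t_p(E_L/L)` (`shaCorank_le_shaCorank_baseChange`) — the restriction `Ш(E/K) → Ш(E_L/L)` has FINITE kernel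
  (tree theorem `finite_ker_shaRestriction`, Darmon 2004 Exercise 3.18) and the `ℤ_p`-corank does not drop along a
  homomorphism with finite kernel between `p`-primary groups with finite `p`-torsion (`zpCorank_le_of_finite_ker`, Greenberg
  1999 §1). Hence a closed door upstairs is a closed door downstairs (`shaCorank_eq_zero_of_baseChange`), `Ш(E_L/L)[p^∞]`
  finite ⟹ `Ш(E/K)[p^∞]` finite (the prime-by-prime form of the tree's `shaFinite_of_baseChange`), and an infinite
  `Ш(E/K)[p^∞]` stays infinite in every finite extension.
* §2 (`K/ℚ` quadratic of discriminant `d_K`, any elliptic `E/ℚ`, ANY prime `p`, `p = 2` included):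
  `t_p(E_K) = t_p(E) + t_p(E^{(d_K)})` (`shaCorank_baseChange_quadratic`) — three discharged tree facts subtracted:
  `corank Sel_{p^∞}(E_K) = corank Sel_{p^∞}(E) + corank Sel_{p^∞}(E^{(d_K)})` (`selmerCorank_baseChange_quadratic_holds`,
  T. Dokchitser 2013 §4 / Dokchitser–Dokchitser 2010 Lemma 4.14), `rank E(K) = rank E(ℚ) + rank E^{(d_K)}(ℚ)`
  (`mordellWeilRank_baseChange_quadratic_holds`, Silverman X Exercise 10.16) and `corank Sel_{p^∞} = rank + corank Ш[p^∞]`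
  over `K` and over `ℚ` (`selmerCorank_eq_mordellWeilRank_add_holds`, Greenberg 1999 §1). So the door over `K` is EXACTLY
  the conjunction of the doors of `E` and of its twist, and `Ш(E_K)[p^∞]` is finite iff both `Ш(E)[p^∞]`, `Ш(E^{(d_K)})[p^∞]`
  are.
* §3 route readings: T ⟹ the transfer for every base change `E_K` to a quadratic field (`transfer_baseChange_quadratic_of_
  transfer`); granting T, ONE closed door of `E_L` over ANY number field `L` closes every door of `E` over `ℚ`
  (`forall_shaCorank_eq_zero_of_transfer_of_baseChange`), and over a quadratic `K` every door of `E`, of `E^{(d_K)}` and of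
  `E_K`; a door for `E_L` is a door for `E` (O may be certified upstairs).

What is NOT here: the group-level decomposition `Ш(E_K)[p^∞] ≅ Ш(E)[p^∞] ⊕ Ш(E^{(d)})[p^∞]` for odd `p` (only coranks are
compared); anything at `p = 2` beyond coranks; any claim on T itself — T stays conjecture-grade at analytic rank ≥ 2 and
BSD is NOT proved by any of this.

## References

* H. Darmon, *Rational points on modular elliptic curves*, CBMS 101 (2004), §3.9 and Exercise 3.18. [Darmon2004]
* T. Dokchitser, Notes on the parity conjecture, CRM Barcelona, Birkhäuser (2013), §4. [Dokchitser2013ParityNotes]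
* T. Dokchitser, V. Dokchitser, On the Birch–Swinnerton-Dyer quotients modulo squares, Ann. of Math. 172 (2010),
  Lemma 4.14. [DokchitserDokchitserAnnals2010]
* R. Greenberg, Iwasawa theory for elliptic curves, LNM 1716 (1999), §1. [Greenberg1999LNM]
* J. H. Silverman, *The Arithmetic of Elliptic Curves*, 2nd ed. (2009), X.4, Exercise 10.16. [SilvermanAEC2009]
-/

-- D-0017: single-problem summit, so `Summit.BirchSwinnertonDyer.BirchSwinnertonDyer.…` repeats a namespace BY DESIGN.
set_option linter.dupNamespace false
set_option autoImplicit false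

noncomputable section

open scoped Classical
open scoped AddSubgroup
open Literature.Algebra.Module Literature.NumberTheory.EllipticCurves WeierstrassCurve
open Summit.BirchSwinnertonDyer.BirchSwinnertonDyer.Theses.ShaPrimaryTransfer

namespace Summit.BirchSwinnertonDyer.BirchSwinnertonDyer.Theorems.ShaPrimaryTransferBaseChange

/-! ## §0 Corank bookkeeping: the `ℤ_p`-corank does not drop along a homomorphism with finite kernel -/

/-- **Monotonicity of the corank along a finite-kernel map.** For `p`-primary abelian groups `A`, `B` with finite
`p`-torsion and a homomorphism `F : A → B` with finite kernel, `zpCorank A p ≤ zpCorank B p`: additivity of the corank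
along `0 → ker F → A → im F → 0` (finite left term) and along `0 → im F → B → B / im F → 0`.
[cite: Greenberg1999LNM, §1 pp. 54–57] -/
theorem zpCorank_le_of_finite_ker {A B : Type*} [AddCommGroup A] [AddCommGroup B] {p : ℕ} [Fact p.Prime]
    (F : A →+ B) (hA : ∀ a : A, ∃ n : ℕ, p ^ n • a = 0) (hB : ∀ b : B, ∃ n : ℕ, p ^ n • b = 0)
    [Finite A[(p : ℤ)]] [Finite B[(p : ℤ)]] [Finite F.ker] : zpCorank A p ≤ zpCorank B p := by
  -- `0 → ker F → A → im F → 0`, finite kernel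
  have h1 : zpCorank A p = zpCorank F.range p :=
    zpCorank_eq_of_shortExact_of_finite_left (i := F.ker.subtype) (f := F.rangeRestrict)
      Subtype.val_injective F.rangeRestrict_surjective
      (fun a ha ↦ ⟨⟨a, by simpa using congrArg (fun z : F.range ↦ (z : B)) ha⟩, rfl⟩)
      (fun a ↦ Subtype.ext a.2) hA
  -- `0 → im F → B → B / im F → 0`
  have h2 : zpCorank B p = zpCorank F.range p + zpCorank (B ⧸ F.range) p :=
    zpCorank_eq_add_of_shortExact (i := F.range.subtype) (f := QuotientAddGroup.mk' F.range)
      Subtype.val_injective (QuotientAddGroup.mk'_surjective _)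
      (fun b hb ↦ ⟨⟨b, (QuotientAddGroup.eq_zero_iff b).mp hb⟩, rfl⟩)
      (fun a ↦ (QuotientAddGroup.eq_zero_iff _).mpr a.2) hB
  omega

/-! ## §1 Any finite extension `L/K` of number fields: `t_p(E/K) ≤ t_p(E_L/L)` -/

section AnyExtension

variable {K : Type} [Field K] [NumberField K] (W : WeierstrassCurve K) [W.IsElliptic]
  (L : Type) [Field L] [NumberField L] [Algebra K L] (p : ℕ) [hp : Fact p.Prime]

/-- **`t_p(E/K) ≤ t_p(E_L/L)` — the corank of `Ш[p^∞]` does not drop under base change.** For an elliptic curve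
`E` over a number field `K`, a finite extension `L/K` and a prime `p`:
`corank_{ℤ_p} Ш(E/K)[p^∞] ≤ corank_{ℤ_p} Ш(E_L/L)[p^∞]`. The restriction `Ш(E/K) → Ш(E_L/L)` (tree
`shaRestriction`) has finite kernel (`finite_ker_shaRestriction`, Darmon 2004 Exercise 3.18: the kernel of
`H¹(K, E) → H¹(L, E)` is inflated from the finite `H¹(Gal(L̃/K), E(L̃))`); restrict it to the `p`-primary parts, which are
`p`-primary with finite `p`-torsion (`Ш[p]` finite, Silverman X.4.2(b), tree `finite_sha_torsionBy_holds`), and apply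
`zpCorank_le_of_finite_ker`. [cite: Darmon2004, §3.9 and Exercise 3.18] [cite: Greenberg1999LNM, §1 pp. 54–57] -/
theorem shaCorank_le_shaCorank_baseChange : W.shaCorank p ≤ (W.baseChange L).shaCorank p := by
  haveI : (W.baseChange L).IsElliptic := by rw [WeierstrassCurve.baseChange]; infer_instance
  have hp0 : ((p : ℕ) : ℤ) ≠ 0 := by exact_mod_cast hp.out.ne_zero
  set f : W.sha →+ (W.baseChange L).sha := shaRestriction W L with hf_def
  set A : AddSubgroup W.sha := AddCommGroup.primaryComponent W.sha p with hA_def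
  set B : AddSubgroup (W.baseChange L).sha := AddCommGroup.primaryComponent (W.baseChange L).sha p with hB_def
  -- `Ш(K) → Ш(L)` maps `p`-primary classes to `p`-primary classes
  have hfmem : ∀ a : A, f a ∈ B := fun a ↦ by
    obtain ⟨k, hk⟩ := (AddCommGroup.mem_primaryComponent).mp a.2
    exact (AddCommGroup.mem_primaryComponent).mpr ⟨k, by rw [← map_nsmul, hk, map_zero]⟩
  let F : A →+ B := (f.comp A.subtype).codRestrict B fun a ↦ hfmem a
  have hF : ∀ a : A, ((F a : B) : (W.baseChange L).sha) = f a := fun _ ↦ rfl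
  -- both are `p`-primary with finite `p`-torsion
  have hAprim : ∀ a : A, ∃ k : ℕ, p ^ k • a = 0 := fun a ↦ by
    obtain ⟨k, hk⟩ := (AddCommGroup.mem_primaryComponent).mp a.2
    exact ⟨k, Subtype.ext (by rw [AddSubgroupClass.coe_nsmul, hk, ZeroMemClass.coe_zero])⟩
  have hBprim : ∀ b : B, ∃ k : ℕ, p ^ k • b = 0 := fun b ↦ by
    obtain ⟨k, hk⟩ := (AddCommGroup.mem_primaryComponent).mp b.2
    exact ⟨k, Subtype.ext (by rw [AddSubgroupClass.coe_nsmul, hk, ZeroMemClass.coe_zero])⟩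
  haveI : Finite ((W.sha)[(p : ℤ)]) := W.finite_sha_torsionBy_holds (p : ℤ) hp0
  haveI : Finite (((W.baseChange L).sha)[(p : ℤ)]) := (W.baseChange L).finite_sha_torsionBy_holds (p : ℤ) hp0
  haveI : Finite (A[(p : ℤ)]) := Nat.finite_of_card_ne_zero (by
    rw [hA_def, natCard_torsionBy_primaryComponent]; exact Nat.card_pos.ne')
  haveI : Finite (B[(p : ℤ)]) := Nat.finite_of_card_ne_zero (by
    rw [hB_def, natCard_torsionBy_primaryComponent]; exact Nat.card_pos.ne')
  -- the kernel of `F` embeds into the finite kernel of `Ш(K) → Ш(L)`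
  haveI : Finite f.ker := (finite_ker_shaRestriction W L).to_subtype
  haveI : Finite F.ker := by
    refine Finite.of_injective (fun x : F.ker ↦ (⟨((x : A) : W.sha), ?_⟩ : f.ker)) ?_
    · rw [AddMonoidHom.mem_ker, ← hF]
      have hx : F x = 0 := x.2
      rw [hx]; rfl
    · intro x y hxy
      exact Subtype.ext (Subtype.ext (congrArg (fun z : f.ker ↦ (z : W.sha)) hxy))
  have key := zpCorank_le_of_finite_ker F hAprim hBprim
  simpa only [shaCorank] using key

/-- **A closed door upstairs is a closed door downstairs**: `t_p(E_L/L) = 0 ⟹ t_p(E/K) = 0` for every finite extension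
`L/K` of number fields. [cite: Darmon2004, §3.9 and Exercise 3.18] -/
theorem shaCorank_eq_zero_of_baseChange (h0 : (W.baseChange L).shaCorank p = 0) : W.shaCorank p = 0 := by
  have h := shaCorank_le_shaCorank_baseChange W L p
  omega

/-- **Positive corank persists upstairs**: `1 ≤ t_p(E/K) ⟹ 1 ≤ t_p(E_L/L)`. [cite: Darmon2004, Exercise 3.18] -/
theorem one_le_shaCorank_baseChange_of_one_le (h1 : 1 ≤ W.shaCorank p) : 1 ≤ (W.baseChange L).shaCorank p :=
  h1.trans (shaCorank_le_shaCorank_baseChange W L p)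

/-- **`Ш(E_L/L)[p^∞]` finite ⟹ `Ш(E/K)[p^∞]` finite**, prime by prime (the `p`-primary form of the tree's
`shaFinite_of_baseChange`, Darmon 2004 §3.9): coranks `0` upstairs, hence downstairs, and `t_p = 0 ⟺ Ш[p^∞]` finite
(`finite_primaryComponent_sha_iff_shaCorank_eq_zero`). [cite: Darmon2004, §3.9 and Exercise 3.18] -/
theorem finite_shaPrimary_of_baseChange (h : Finite ↥(AddCommGroup.primaryComponent (W.baseChange L).sha p)) :
    Finite ↥(AddCommGroup.primaryComponent W.sha p) := by
  haveI : (W.baseChange L).IsElliptic := by rw [WeierstrassCurve.baseChange]; infer_instance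
  rw [finite_primaryComponent_sha_iff_shaCorank_eq_zero] at h ⊢
  exact shaCorank_eq_zero_of_baseChange W L p h

/-- **An infinite `Ш(E/K)[p^∞]` stays infinite in every finite extension.** [cite: Darmon2004, Exercise 3.18] -/
theorem infinite_shaPrimary_baseChange_of_infinite (h : Infinite ↥(AddCommGroup.primaryComponent W.sha p)) :
    Infinite ↥(AddCommGroup.primaryComponent (W.baseChange L).sha p) := by
  rw [← not_finite_iff_infinite] at h ⊢
  exact fun hL ↦ h (finite_shaPrimary_of_baseChange W L p hL)

/-- **A door for `E_L` is a door for `E`**: if SOME prime has `t_p(E_L/L) = 0` then some prime has `t_p(E/K) = 0` (the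
door O of the route may be certified over any finite extension). [cite: Darmon2004, §3.9 and Exercise 3.18] -/
theorem exists_shaCorank_eq_zero_of_baseChange (h : ∃ (q : ℕ) (_ : Fact q.Prime), (W.baseChange L).shaCorank q = 0) :
    ∃ (q : ℕ) (_ : Fact q.Prime), W.shaCorank q = 0 := by
  obtain ⟨q, hq, h0⟩ := h
  exact ⟨q, hq, shaCorank_eq_zero_of_baseChange W L q h0⟩

end AnyExtension

/-! ## §2 A quadratic field: `t_p(E_K) = t_p(E) + t_p(E^{(d_K)})` for every prime `p` -/

section Quadratic

variable (W : WeierstrassCurve ℚ) [W.IsElliptic] (K : Type) [Field K] [NumberField K]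
  (p : ℕ) [hp : Fact p.Prime]

/-- **`t_p(E_K) = t_p(E/ℚ) + t_p(E^{(d_K)}/ℚ)` for a quadratic field `K` of discriminant `d_K` and EVERY prime `p`**
(`p = 2` included): `corank_{ℤ_p} Ш(E_K/K)[p^∞] = corank_{ℤ_p} Ш(E/ℚ)[p^∞] + corank_{ℤ_p} Ш(E^{(d_K)}/ℚ)[p^∞]`.
Subtract the discharged tree facts `rank E(K) = rank E(ℚ) + rank E^{(d_K)}(ℚ)` (Silverman X Exercise 10.16,
`mordellWeilRank_baseChange_quadratic_holds`) and `corank Sel_{p^∞} = rank + corank Ш[p^∞]` (Greenberg 1999 §1,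
`selmerCorank_eq_mordellWeilRank_add_holds`, over `K` and twice over `ℚ`) from
`corank Sel_{p^∞}(E_K) = corank Sel_{p^∞}(E) + corank Sel_{p^∞}(E^{(d_K)})` (T. Dokchitser 2013 §4, Dokchitser–Dokchitser
2010 Lemma 4.14, tree `selmerCorank_baseChange_quadratic_holds`).
[cite: Dokchitser2013ParityNotes, §4, proof of the Theorem "[Squarity, NekIV, Kurast]", first display]
[cite: DokchitserDokchitserAnnals2010, Lemma 4.14] [cite: SilvermanAEC2009, Exercise 10.16] -/
theorem shaCorank_baseChange_quadratic (h2 : Module.finrank ℚ K = 2) :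
    (W.baseChange K).shaCorank p =
      W.shaCorank p + (W.quadraticTwist (NumberField.discr K : ℚ)).shaCorank p := by
  haveI : (W.baseChange K).IsElliptic := by rw [WeierstrassCurve.baseChange]; infer_instance
  have hd : ((NumberField.discr K : ℤ) : ℚ) ≠ 0 := by exact_mod_cast NumberField.discr_ne_zero K
  haveI : (W.quadraticTwist (NumberField.discr K : ℚ)).IsElliptic := W.isElliptic_quadraticTwist hd
  have hS := selmerCorank_baseChange_quadratic_holds W K h2 p
  have hR := mordellWeilRank_baseChange_quadratic_holds W K h2
  have hK := (W.baseChange K).selmerCorank_eq_mordellWeilRank_add_holds p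
  have hQ := W.selmerCorank_eq_mordellWeilRank_add_holds p
  have hT := (W.quadraticTwist (NumberField.discr K : ℚ)).selmerCorank_eq_mordellWeilRank_add_holds p
  omega

/-- **The door over a quadratic field is the conjunction of two doors over `ℚ`**:
`t_p(E_K) = 0 ⟺ t_p(E) = 0 ∧ t_p(E^{(d_K)}) = 0`. [cite: Dokchitser2013ParityNotes, §4] -/
theorem shaCorank_baseChange_eq_zero_iff (h2 : Module.finrank ℚ K = 2) :
    (W.baseChange K).shaCorank p = 0 ↔
      W.shaCorank p = 0 ∧ (W.quadraticTwist (NumberField.discr K : ℚ)).shaCorank p = 0 := by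
  have h := shaCorank_baseChange_quadratic W K p h2
  omega

/-- **The twist's corank is bounded by the corank over `K`**: `t_p(E^{(d_K)}) ≤ t_p(E_K)` (the companion bound
`t_p(E) ≤ t_p(E_K)` is §1). [cite: Dokchitser2013ParityNotes, §4] -/
theorem shaCorank_quadraticTwist_le_baseChange (h2 : Module.finrank ℚ K = 2) :
    (W.quadraticTwist (NumberField.discr K : ℚ)).shaCorank p ≤ (W.baseChange K).shaCorank p := by
  have h := shaCorank_baseChange_quadratic W K p h2
  omega

/-- **The corank over `K` is positive iff one of the two `ℚ`-coranks is**: `1 ≤ t_p(E_K) ⟺ 1 ≤ t_p(E) ∨ 1 ≤ t_p(E^{(d_K)})`.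
[cite: Dokchitser2013ParityNotes, §4] -/
theorem one_le_shaCorank_baseChange_iff (h2 : Module.finrank ℚ K = 2) :
    1 ≤ (W.baseChange K).shaCorank p ↔
      1 ≤ W.shaCorank p ∨ 1 ≤ (W.quadraticTwist (NumberField.discr K : ℚ)).shaCorank p := by
  have h := shaCorank_baseChange_quadratic W K p h2
  omega

/-- **Parity over `K`**: `t_p(E_K) ≡ t_p(E) + t_p(E^{(d_K)}) (mod 2)`; in particular `t_p(E_K)` is even iff the two
`ℚ`-coranks have the same parity. [cite: Dokchitser2013ParityNotes, §4] -/
theorem even_shaCorank_baseChange_iff (h2 : Module.finrank ℚ K = 2) :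
    Even ((W.baseChange K).shaCorank p) ↔
      (Even (W.shaCorank p) ↔ Even ((W.quadraticTwist (NumberField.discr K : ℚ)).shaCorank p)) := by
  rw [shaCorank_baseChange_quadratic W K p h2, Nat.even_add]

/-- **`Ш(E_K)[p^∞]` is finite iff both `Ш(E/ℚ)[p^∞]` and `Ш(E^{(d_K)}/ℚ)[p^∞]` are** (every prime `p`).
[cite: Dokchitser2013ParityNotes, §4] [cite: Darmon2004, §3.9] -/
theorem finite_shaPrimary_baseChange_iff (h2 : Module.finrank ℚ K = 2) :
    Finite ↥(AddCommGroup.primaryComponent (W.baseChange K).sha p) ↔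
      Finite ↥(AddCommGroup.primaryComponent W.sha p) ∧
        Finite ↥(AddCommGroup.primaryComponent (W.quadraticTwist (NumberField.discr K : ℚ)).sha p) := by
  haveI : (W.baseChange K).IsElliptic := by rw [WeierstrassCurve.baseChange]; infer_instance
  have hd : ((NumberField.discr K : ℤ) : ℚ) ≠ 0 := by exact_mod_cast NumberField.discr_ne_zero K
  haveI : (W.quadraticTwist (NumberField.discr K : ℚ)).IsElliptic := W.isElliptic_quadraticTwist hd
  rw [finite_primaryComponent_sha_iff_shaCorank_eq_zero, finite_primaryComponent_sha_iff_shaCorank_eq_zero,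
    finite_primaryComponent_sha_iff_shaCorank_eq_zero]
  exact shaCorank_baseChange_eq_zero_iff W K p h2

/-- **A finite `Ш(E_K)[p^∞]` (e.g. from Kolyvagin over a Heegner field `K`) closes the door at `p` for `E` AND for its
twist `E^{(d_K)}` over `ℚ`.** [cite: Dokchitser2013ParityNotes, §4] [cite: Darmon2004, §3.9] -/
theorem shaCorank_eq_zero_and_of_finite_shaPrimary_baseChange (h2 : Module.finrank ℚ K = 2)
    (h : Finite ↥(AddCommGroup.primaryComponent (W.baseChange K).sha p)) :
    W.shaCorank p = 0 ∧ (W.quadraticTwist (NumberField.discr K : ℚ)).shaCorank p = 0 := by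
  haveI : (W.baseChange K).IsElliptic := by rw [WeierstrassCurve.baseChange]; infer_instance
  rw [finite_primaryComponent_sha_iff_shaCorank_eq_zero] at h
  exact (shaCorank_baseChange_eq_zero_iff W K p h2).mp h

end Quadratic

/-! ## §3 Route readings: what T and O say over number fields -/

section Route

/-- **T ⟹ the transfer for every base change to a quadratic field**: granting T = `FiniteShaComponentTransfer` (over `ℚ`),
for every elliptic `E/ℚ`, every quadratic field `K` and all primes `p, q`: `t_p(E_K) = 0 ⟹ t_q(E_K) = 0` — the door of
`E_K` at `p` is the pair of doors of `E`, `E^{(d_K)}` at `p` (§2), T moves each to `q`, and §2 reassembles.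
[cite: Dokchitser2013ParityNotes, §4] -/
theorem transfer_baseChange_quadratic_of_transfer (hT : FiniteShaComponentTransfer) (W : WeierstrassCurve ℚ)
    [W.IsElliptic] (K : Type) [Field K] [NumberField K] (h2 : Module.finrank ℚ K = 2) (p q : ℕ) [Fact p.Prime]
    [Fact q.Prime] (h0 : (W.baseChange K).shaCorank p = 0) : (W.baseChange K).shaCorank q = 0 := by
  have hd : ((NumberField.discr K : ℤ) : ℚ) ≠ 0 := by exact_mod_cast NumberField.discr_ne_zero K
  haveI : (W.quadraticTwist (NumberField.discr K : ℚ)).IsElliptic := W.isElliptic_quadraticTwist hd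
  obtain ⟨hE, hEd⟩ := (shaCorank_baseChange_eq_zero_iff W K p h2).mp h0
  exact (shaCorank_baseChange_eq_zero_iff W K q h2).mpr
    ⟨hT W p q hE, hT (W.quadraticTwist (NumberField.discr K : ℚ)) p q hEd⟩

/-- **Granting T, ONE closed door upstairs closes every door downstairs**: for every number field `L`, every elliptic
`E/ℚ` and primes `p, q`: `t_p(E_L/L) = 0 ⟹ t_q(E/ℚ) = 0` (§1 brings the door down to `ℚ`, T moves it to `q`).
[cite: Darmon2004, §3.9 and Exercise 3.18] -/
theorem forall_shaCorank_eq_zero_of_transfer_of_baseChange (hT : FiniteShaComponentTransfer) (W : WeierstrassCurve ℚ)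
    [W.IsElliptic] (L : Type) [Field L] [NumberField L] (p : ℕ) [Fact p.Prime]
    (h0 : (W.baseChange L).shaCorank p = 0) (q : ℕ) [Fact q.Prime] : W.shaCorank q = 0 :=
  hT W p q (shaCorank_eq_zero_of_baseChange W L p h0)

/-- **Granting T, one closed door of `E_K` (`K` quadratic) closes every door of `E`, of `E^{(d_K)}` and of `E_K`.**
[cite: Dokchitser2013ParityNotes, §4] -/
theorem forall_shaCorank_eq_zero_of_transfer_of_baseChange_quadratic (hT : FiniteShaComponentTransfer)
    (W : WeierstrassCurve ℚ) [W.IsElliptic] (K : Type) [Field K] [NumberField K] (h2 : Module.finrank ℚ K = 2)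
    (p : ℕ) [Fact p.Prime] (h0 : (W.baseChange K).shaCorank p = 0) (q : ℕ) [Fact q.Prime] :
    W.shaCorank q = 0 ∧ (W.quadraticTwist (NumberField.discr K : ℚ)).shaCorank q = 0 ∧
      (W.baseChange K).shaCorank q = 0 := by
  have hK := transfer_baseChange_quadratic_of_transfer hT W K h2 p q h0
  exact ⟨((shaCorank_baseChange_eq_zero_iff W K q h2).mp hK).1,
    ((shaCorank_baseChange_eq_zero_iff W K q h2).mp hK).2, hK⟩

/-- **O may be certified upstairs**: if every elliptic curve over `ℚ` acquires a closed door over SOME number field, then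
O = `OneFiniteShaComponent` holds. [cite: Darmon2004, §3.9 and Exercise 3.18] -/
theorem oneFiniteShaComponent_of_doors_baseChange
    (h : ∀ (W : WeierstrassCurve ℚ) [W.IsElliptic], ∃ (L : Type) (_ : Field L) (_ : NumberField L)
      (q : ℕ) (_ : Fact q.Prime), (W.baseChange L).shaCorank q = 0) :
    OneFiniteShaComponent := by
  intro W _
  obtain ⟨L, _, _, q, hq, h0⟩ := h W
  exact ⟨q, hq, shaCorank_eq_zero_of_baseChange W L q h0⟩

/-- **The kernel T ∧ O read upstairs**: granting T and O, every base change of every elliptic `E/ℚ` to a quadratic field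
has `t_q(E_K) = 0` at EVERY prime `q`. [cite: Dokchitser2013ParityNotes, §4] -/
theorem forall_shaCorank_baseChange_quadratic_eq_zero_of_transfer_of_door (hT : FiniteShaComponentTransfer)
    (hO : OneFiniteShaComponent) (W : WeierstrassCurve ℚ) [W.IsElliptic] (K : Type) [Field K] [NumberField K]
    (h2 : Module.finrank ℚ K = 2) (q : ℕ) [Fact q.Prime] : (W.baseChange K).shaCorank q = 0 := by
  have hd : ((NumberField.discr K : ℤ) : ℚ) ≠ 0 := by exact_mod_cast NumberField.discr_ne_zero K
  haveI : (W.quadraticTwist (NumberField.discr K : ℚ)).IsElliptic := W.isElliptic_quadraticTwist hd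
  obtain ⟨p, hp, hE⟩ := hO W
  obtain ⟨p', hp', hEd⟩ := hO (W.quadraticTwist (NumberField.discr K : ℚ))
  exact (shaCorank_baseChange_eq_zero_iff W K q h2).mpr
    ⟨hT W p q hE, hT (W.quadraticTwist (NumberField.discr K : ℚ)) p' q hEd⟩

end Route

end Summit.BirchSwinnertonDyer.BirchSwinnertonDyer.Theorems.ShaPrimaryTransferBaseChange

end
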